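import Summits.FinalStateConjecture.FinalStateConjecture.Theorems.WeakCosmicCensorshipMGHD.Negative.TruncatedMinkowski
import Literature.Geometry.Lorentzian.InitialDataPullback
import Literature.Geometry.Lorentzian.GeodesicExtension
import Literature.Geometry.Lorentzian.LeviCivitaProofs
import Literature.Geometry.Lorentzian.GeodesicProofs

/-!
# The lever `stub_scriTransfer` of line `scri-transfer-third-of-burial` is FALSE without its
# time-orientation clause — negative-side support for the crux `WeakCosmicCensorshipMGHD`
# (item `stmt-FinalStateConjecture-9952`, route PhaseMixingCapture)

The picked line's lever (skeleton v2, `Cruxes/WeakCosmicCensorshipMGHD/Lines/scri-transfer-third-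
of-burial.lean`, registered stub `stub_scriTransfer`) transfers far-origin completeness of `𝓘⁺`
(sojourn form) from a data embedding `𝒮` of a sub-datum UP along a smooth isometric open
embedding `χ : 𝒮 → 𝒟` over `Φ` which PRESERVES THE TIME ORIENTATIONS. This file proves that the
orientation clause is load-bearing ("any proof must use it"): the statement with
`𝒮.timeOrientation.PreservesTimeOrientation χ 𝒟.timeOrientation` deleted and everything else
verbatim (`ScriTransferWithoutOrientation`) is false (`scriTransferWithoutOrientation_false`).

Witness (all over the repaired carrier `DataEmbedding`/`CauchyDevelopment`, no named facts):
`𝒟 = truncated` is time-truncated Minkowski space `{x⁰ < 1}` (landed `TruncatedMinkowski.lean`: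
a vacuum Cauchy development of the trivial datum `(ℝ³, δ, 0)` with INCOMPLETE `𝓘⁺`,
`not_hasCompleteNullInfinity_truncated`); `𝒮 = reversedCut` is THE SAME open sub-spacetime
with the REVERSED time orientation `-∂ₜ` and the normal `-∂ₜ` — again a data embedding of
`(ℝ³, δ, 0)` because `k = 0` is odd under `ν ↦ -ν` (`secondFundamentalForm_neg_normal'`);
`N = X = ℝ³`, `Φ = id`, `χ = id` (smooth, open, isometric, `χ ∘ ι = ι`, but orientation
REVERSING), `K = ∅`. The relative far-completeness hypothesis holds for `𝒮` with room to spare: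
EVERY normalised future null ray of `reversedCut` from the slice — a maximal null geodesic with
initial velocity `v`, `v⁰ = -1` — contains the whole half-line `(-1, ∞)` in its affine domain
(`Ioi_subset_dom_of_isMaximalGeodesicOn`: the explicit null line `t ↦ (0, y) + t v` is a geodesic of
the cut on `(-1, ∞)`, and a maximal geodesic with the same tangent lift at `0` absorbs it, by the
tree's gluing lemma `IsGeodesicOn.piecewise`), hence is future complete; yet the conclusion
`HasCompleteNullInfinity truncated` is false.

Refuter seat `refuter-drefute-stmt-FinalStateConjecture-9952-g3-0` (drefute gen 3), 2026-08-16.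
All results proved; `sorry`-free; axioms standard.

## References

* B. O'Neill, *Semi-Riemannian geometry*, Academic Press 1983, Ch. 3, Lemma 23 and p. 68
  (uniqueness and maximal geodesics), Example 25 (geodesics of `ℝⁿ₁` are lines), Ch. 5, p. 145
  (time orientation).
* D. Christodoulou, CQG 16 (1999) A23, pp. A26–A27 (complete future null infinity).
-/

noncomputable section

open Bundle Set Function Filter TopologicalSpace Topology MeasureTheory
open scoped Manifold ContDiff Topology

set_option linter.dupNamespace false

namespace Summit.FinalStateConjecture.FinalStateConjecture.Theorems.WeakCosmicCensorshipMGHD.Negative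

open Literature.Geometry.Lorentzian Literature.Geometry.Lorentzian.Minkowski

/-! ### The lever with the orientation clause deleted -/

/-- **`Sig.stub_scriTransfer` of the picked line WITHOUT `PreservesTimeOrientation χ`**
(everything else character-for-character the registered stub of skeleton v2 @45c9656a9313):
far-origin relative completeness of a data embedding `𝒮` of `Φ^* D` would ascend along ANY smooth
isometric open embedding `χ : 𝒮 → 𝒟` over `Φ`. False: `scriTransferWithoutOrientation_false`. -/
def ScriTransferWithoutOrientation : Prop :=
  ∀ (X : Type) [TopologicalSpace X] [ChartedSpace E3 X] [IsManifold (𝓡 3) ∞ X]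
    [T2Space X] [SecondCountableTopology X] [ConnectedSpace X]
    (D : InitialDataSet (𝓡 3) X) (𝒟 : CauchyDevelopment D)
    (N : Type) [TopologicalSpace N] [ChartedSpace E3 N] [IsManifold (𝓡 3) ∞ N] [ConnectedSpace N]
    (Φ : N → X) (hΦ : ContMDiff (𝓡 3) (𝓡 3) (∞ + 1) Φ)
    (hΦ' : ∀ u, Function.Injective (mfderiv (𝓡 3) (𝓡 3) Φ u)),
    Topology.IsOpenEmbedding Φ →
    ∀ (𝒮 : DataEmbedding (D.comap Φ hΦ hΦ')) (χ : 𝒮.carrier → 𝒟.carrier),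
      ContMDiff (𝓡 4) (𝓡 4) ∞ χ → Topology.IsOpenEmbedding χ →
      𝒮.metric.IsIsometricImmersion 𝒟.metric.toPseudoRiemannianMetric χ →
      χ ∘ 𝒮.embed = 𝒟.embed ∘ Φ →
      ∀ (K : Set X), IsCompact K → Kᶜ ⊆ Set.range Φ →
      (∀ [𝒮.metric.HasLeviCivita],
        ∃ K₀ : Set X, IsCompact K₀ ∧ ∀ s : ℝ, 0 < s → ∃ K₁ : Set X, IsCompact K₁ ∧
          ∀ p : N, Φ p ∉ K₁ → ∀ (γ : ℝ → 𝒮.carrier) (dom : Set ℝ),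
            𝒮.metric.IsNormalisedNullRayFrom 𝒮.timeOrientation 𝒮.embed 𝒮.normal p γ dom →
            ¬ BddAbove dom ∨ ENNReal.ofReal s ≤ sojournTime γ dom
              (𝒮.metric.causalFuture 𝒮.timeOrientation (𝒮.embed '' (Φ ⁻¹' K₀)))) →
      _root_.Summit.FinalStateConjecture.HasCompleteNullInfinity 𝒟

/-! ### `K_{-ν} = -K_ν`, unconditionally -/

section NegNormal

variable {E : Type*} [NormedAddCommGroup E] [NormedSpace ℝ E] {H : Type*} [TopologicalSpace H]
  {I : ModelWithCorners ℝ E H} {M : Type*} [TopologicalSpace M] [ChartedSpace H M]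
  {E' : Type*} [NormedAddCommGroup E'] [NormedSpace ℝ E'] {H' : Type*} [TopologicalSpace H']
  {I' : ModelWithCorners ℝ E' H'} {N : Type*} [TopologicalSpace N] [ChartedSpace H' N]

/-- `D(a W)/dt = a DW/dt` in the canonical frame, unconditionally (the local-frame formula is
linear in `W`). [folklore] -/
theorem covariantDerivAlong_const_smul' [IsManifold I ∞ M] [FiniteDimensional ℝ E]
    (cov : CovariantDerivative I E (TangentSpace I : M → Type _)) (γ : ℝ → M)
    (W : Π t : ℝ, TangentSpace I (γ t)) (t₀ a : ℝ) :
    covariantDerivAlong cov γ (fun t ↦ a • W t) t₀ = a • covariantDerivAlong cov γ W t₀ := by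
  show covariantDerivAlongFrame cov _ _ γ (fun t ↦ a • W t) t₀ =
    a • covariantDerivAlongFrame cov _ _ γ W t₀
  simp only [covariantDerivAlongFrame, map_smul, smul_eq_mul, deriv_const_mul_field, mul_smul,
    smul_add, Finset.smul_sum]

/-- `D_v(-ν) = -D_v ν` for a field along `f`, unconditionally. [folklore] -/
theorem normalDerivAlong_neg' [IsManifold I ∞ M] [FiniteDimensional ℝ E] [CompleteSpace E]
    {n : ℕ∞ω} [Fact (1 ≤ n)] (g : PseudoRiemannianMetric I n E (TangentSpace I : M → Type _))
    [g.HasLeviCivita] (f : N → M) (ν : NormalField I f) (y : N) (v : TangentSpace I' y) :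
    (g.normalDerivAlong f (fun y ↦ -ν y) y v : E) = -(g.normalDerivAlong f ν y v : E) := by
  show (covariantDerivAlong g.leviCivita (f ∘ curveThrough I' y v)
      (fun t ↦ -ν (curveThrough I' y v t)) 0 : E) =
    -(covariantDerivAlong g.leviCivita (f ∘ curveThrough I' y v)
      (fun t ↦ ν (curveThrough I' y v t)) 0 : E)
  have h1 : covariantDerivAlong g.leviCivita (f ∘ curveThrough I' y v)
      (fun t ↦ -ν (curveThrough I' y v t)) 0 =
      covariantDerivAlong g.leviCivita (f ∘ curveThrough I' y v)
        (fun t ↦ (-1 : ℝ) • ν (curveThrough I' y v t)) 0 := by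
    congr 1
    funext t
    exact (neg_one_smul ℝ _).symm
  have h2 := covariantDerivAlong_const_smul' g.leviCivita (f ∘ curveThrough I' y v)
    (fun t ↦ ν (curveThrough I' y v t)) 0 (-1)
  exact (h1.trans h2).trans (neg_one_smul ℝ _)

/-- **`K_{-ν} = -K_ν` with no side condition**: the tree's second fundamental form is defined by
`Module.Basis.constr` from `g(D_{bᵢ} ν, df w)` on the canonical basis, and `D_{bᵢ}(-ν) = -D_{bᵢ} ν`
holds unconditionally (`normalDerivAlong_neg'`). O'Neill 1983, Ch. 4, Lemma 4.4 ff.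
[cite: ONeill1983, Ch. 4, Lemma 4.4] -/
theorem secondFundamentalForm_neg_normal' [IsManifold I ∞ M] [FiniteDimensional ℝ E]
    [CompleteSpace E] {n : ℕ∞ω} [Fact (1 ≤ n)] [FiniteDimensional ℝ E']
    (g : PseudoRiemannianMetric I n E (TangentSpace I : M → Type _)) [g.HasLeviCivita]
    (f : N → M) (ν : NormalField I f) (y : N) :
    g.secondFundamentalForm I' f (fun y ↦ -ν y) y = -g.secondFundamentalForm I' f ν y := by
  haveI : FiniteDimensional ℝ (TangentSpace I' y) := inferInstanceAs (FiniteDimensional ℝ E')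
  refine (Module.finBasis ℝ (TangentSpace I' y)).ext fun i ↦ LinearMap.ext fun w ↦ ?_
  rw [LinearMap.neg_apply, LinearMap.neg_apply, g.secondFundamentalForm_apply_basis,
    g.secondFundamentalForm_apply_basis]
  have h := normalDerivAlong_neg' g f ν y (Module.finBasis ℝ (TangentSpace I' y) i)
  show g.val (f y) (g.normalDerivAlong f (fun y ↦ -ν y) y _ : E) (mfderiv I' I f y w) =
    -g.val (f y) (g.normalDerivAlong f ν y _ : E) (mfderiv I' I f y w)
  rw [h, map_neg, _root_.neg_apply]

end NegNormal

/-! ### The time-reversed cut: the same sub-spacetime `{x⁰ < 1}` with orientation `-∂ₜ` -/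

/-- **Time-reversed truncated Minkowski space as a data embedding of the trivial datum**: the open
sub-spacetime `{x⁰ < 1}` of Minkowski space with metric `η`, the REVERSED time orientation `-∂ₜ`,
the slice `{x⁰ = 0}` and its reversed-future unit normal `-∂ₜ`. The induced metric is `δ` and the
second fundamental form is `-0 = 0`, so this is again a `DataEmbedding` of `(ℝ³, δ, 0)`. -/
def reversedCut : DataEmbedding trivialData where
  toSpacetime :=
    { carrier := futureCut
      metric := cutMetric
      timeOrientation := cutOrientation.reverse
      connectedSpace := isConnected_iff_connectedSpace.mp isConnected_futureCut }
  embed := truncated.embed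
  isSmoothEmbedding := truncated.isSmoothEmbedding
  normal := fun y ↦ -truncated.normal y
  isFutureUnitNormal := by
    refine ⟨⟨fun y v ↦ ?_, fun y ↦ ?_⟩, fun y ↦ ?_⟩
    · have h : truncated.metric.val (truncated.embed y) (-truncated.normal y)
          (mfderiv (𝓡 3) (𝓡 4) truncated.embed y v) = 0 := by
        rw [map_neg, _root_.neg_apply, truncated.isFutureUnitNormal.1.1 y v, neg_zero]
      exact h
    · have h : truncated.metric.val (truncated.embed y) (-truncated.normal y)
          (-truncated.normal y) = -1 := by
        rw [map_neg, map_neg, _root_.neg_apply, neg_neg]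
        exact truncated.isFutureUnitNormal.1.2 y
      exact h
    · have h : truncated.timeOrientation.IsPastDirected (-truncated.normal y) := by
        rw [← TimeOrientation.isFutureDirected_neg_iff, neg_neg]
        exact truncated.isFutureUnitNormal.2 y
      exact (truncated.timeOrientation.isFutureDirected_reverse_iff (-truncated.normal y)).2 h
  induced_h := truncated.induced_h
  induced_k := by
    intro inst y
    haveI : truncated.metric.toPseudoRiemannianMetric.HasLeviCivita := inst
    have hk : truncated.metric.toPseudoRiemannianMetric.secondFundamentalForm (𝓡 3) truncated.embed
        truncated.normal y = trivialData.kBilin y := truncated.induced_k y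
    have h0 : trivialData.kBilin y = 0 := by
      ext v w
      rw [InitialDataSet.kBilin_apply, trivialData_k]
      rfl
    have e := secondFundamentalForm_neg_normal' (I' := 𝓡 3) truncated.metric.toPseudoRiemannianMetric
      truncated.embed truncated.normal y
    have e' : truncated.metric.toPseudoRiemannianMetric.secondFundamentalForm (𝓡 3) truncated.embed
        (fun y ↦ -truncated.normal y) y = 0 := by
      rw [e, hk, h0]
      exact neg_zero (G := LinearMap.BilinForm ℝ (TangentSpace (𝓡 3) y))
    exact e'.trans h0.symm

/-- The metric of the reversed cut is the restricted `η` (by `rfl`). -/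
theorem reversedCut_metric : reversedCut.metric = cutMetric := rfl

/-- The time orientation of the reversed cut is `-∂ₜ` (by `rfl`). -/
theorem reversedCut_timeOrientation : reversedCut.timeOrientation = cutOrientation.reverse := rfl

/-- The embedding of the reversed cut is that of the truncated development (by `rfl`). -/
theorem reversedCut_embed : reversedCut.embed = truncated.embed := rfl

/-- The normal of the reversed cut is `-∂ₜ` (by `rfl`). -/
theorem reversedCut_normal : reversedCut.normal = fun y ↦ -truncated.normal y := rfl

/-! ### The null lines `t ↦ (0, y) + t v`, `v⁰ = -1`, of the cut -/

/-- Clamp of the parameter to `(-1, ∞)` (value `0` outside), keeping the lines inside the cut for all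
real parameters. -/
def θ' (t : ℝ) : ℝ := if -1 < t then t else 0

/-- Within `(-1, ∞)` the clamp is the identity. -/
theorem θ'_of_lt {t : ℝ} (h : -1 < t) : θ' t = t := if_pos h

/-- The clamp is always `> -1`. -/
theorem neg_one_lt_θ' (t : ℝ) : -1 < θ' t := by
  unfold θ'
  split_ifs with h
  · exact h
  · norm_num

/-- Coordinates of the line `t ↦ (0, y) + θ'(t) v`. -/
def lineCoord (y : slice) (v : E4) (t : ℝ) : E4 := sliceEmbed y + θ' t • v

/-- The time coordinate along the line is `θ'(t) v⁰`. -/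
theorem lineCoord_apply_zero (y : slice) (v : E4) (t : ℝ) : lineCoord y v t 0 = θ' t * v 0 := by
  simp [lineCoord, sliceEmbed_apply]

/-- For `v⁰ = -1` the line stays in the cut `{x⁰ < 1}`. -/
theorem lineCoord_mem (y : slice) {v : E4} (hv : v 0 = -1) (t : ℝ) : lineCoord y v t ∈ futureCut := by
  rw [mem_futureCut, lineCoord_apply_zero, hv]
  linarith [neg_one_lt_θ' t]

/-- The line as a curve in the cut. -/
def line (y : slice) (v : E4) (hv : v 0 = -1) (t : ℝ) : futureCut := ⟨lineCoord y v t, lineCoord_mem y hv t⟩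

/-- Near a parameter `t > -1` the line is the affine map `s ↦ (0, y) + s v`. -/
theorem lineCoord_eventuallyEq (y : slice) (v : E4) {t : ℝ} (ht : -1 < t) :
    lineCoord y v =ᶠ[𝓝 t] fun s ↦ sliceEmbed y + s • v := by
  filter_upwards [Ioi_mem_nhds ht] with s hs
  rw [lineCoord, θ'_of_lt hs]

/-- On `(-1, ∞)` the line has derivative `v`. -/
theorem hasDerivAt_lineCoord (y : slice) (v : E4) {t : ℝ} (ht : -1 < t) :
    HasDerivAt (lineCoord y v) v t := by
  have h : HasDerivAt (fun s : ℝ ↦ sliceEmbed y + s • v) v t := by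
    simpa using ((hasDerivAt_id t).smul_const v).const_add (sliceEmbed y)
  exact h.congr_of_eventuallyEq (lineCoord_eventuallyEq y v ht)

/-- The line starts at `ι y`. -/
theorem line_zero (y : slice) (v : E4) (hv : v 0 = -1) : line y v hv 0 = truncated.embed y := by
  apply Subtype.ext
  change lineCoord y v 0 = sliceEmbed y
  simp [lineCoord, θ'_of_lt (show (-1 : ℝ) < 0 by norm_num)]

/-- **The lines are geodesics of the cut on `(-1, ∞)` with velocity `v`** (straight lines; O'Neill
1983, Ch. 3, Example 25, via `OpensChart.isGeodesicOn_of_hasDerivAt` and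
`christoffel_cut_eq_zero`). -/
theorem isGeodesicOn_line [cutMetric.toPseudoRiemannianMetric.HasLeviCivita] (y : slice) (v : E4)
    (hv : v 0 = -1) :
    IsGeodesicOn cutMetric.toPseudoRiemannianMetric.leviCivita (line y v hv) (Ioi (-1)) ∧
      ∀ t ∈ Ioi (-1 : ℝ), velocity 𝓘(ℝ, E4) (line y v hv) t = v :=
  OpensChart.isGeodesicOn_of_hasDerivAt (g := cutMetric.toPseudoRiemannianMetric)
    (G := fun _ : E4 ↦ bilin) (fun _ ↦ rfl) (fun _ ↦ differentiableAt_const _) isOpen_Ioi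
    (c := lineCoord y v) (c' := fun _ ↦ v) (c'' := fun _ ↦ 0) (fun _ ↦ rfl)
    (fun t ht ↦ hasDerivAt_lineCoord y v ht) (fun t _ ↦ hasDerivAt_const t v)
    (fun t _ ↦ by rw [christoffel_cut_eq_zero, add_zero])

/-! ### Every maximal geodesic of the cut launched from the slice with `v⁰ = -1` lives on `(-1, ∞)` -/

/-- **A maximal geodesic of the cut with initial point `(0, y)` and initial velocity `v`, `v⁰ = -1`,
is defined on all of `(-1, ∞)`**: glue it with the explicit line (same tangent lift at `0`,
`IsGeodesicOn.piecewise` — uniqueness and locality of the geodesic equation for the `C¹`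
Levi-Civita connection of the cut) and use maximality. O'Neill 1983, Ch. 3, Lemma 23 and p. 68.
[cite: ONeill1983, Ch. 3, Lemma 23] -/
theorem Ioi_subset_dom_of_isMaximalGeodesicOn [cutMetric.toPseudoRiemannianMetric.HasLeviCivita]
    {γ : ℝ → futureCut} {dom : Set ℝ}
    (hγ : IsMaximalGeodesicOn cutMetric.toPseudoRiemannianMetric.leviCivita γ dom)
    (h0 : (0 : ℝ) ∈ dom) {y : slice} (hγ0 : γ 0 = truncated.embed y) {v : E4}
    (hvel : velocity 𝓘(ℝ, E4) γ 0 = v) (hv : v 0 = -1) : Ioi (-1 : ℝ) ⊆ dom := by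
  classical
  haveI : CovariantDerivative.ContMDiffCovariantDerivative
      cutMetric.toPseudoRiemannianMetric.leviCivita 1 :=
    ⟨cutMetric.toPseudoRiemannianMetric.isLocallyContMDiff_leviCivita_holds 1
      (by rw [show ((1 : ℕ∞) : ℕ∞ω) + 1 = 2 by norm_num]; exact WithTop.coe_le_coe.2 le_top)
      univ isOpen_univ⟩
  obtain ⟨hβ, hβv⟩ := isGeodesicOn_line y v hv
  have hm1 : (-1 : ℝ) < 0 := by norm_num
  have hlift : tangentLift 𝓘(ℝ, E4) γ 0 = tangentLift 𝓘(ℝ, E4) (line y v hv) 0 :=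
    TotalSpace.ext (hγ0.trans (line_zero y v hv).symm) (heq_of_eq (hvel.trans (hβv 0 hm1).symm))
  obtain ⟨hglue, hglueγ, -⟩ := IsGeodesicOn.piecewise (cov := cutMetric.toPseudoRiemannianMetric.leviCivita)
    hγ.isOpen isOpen_Ioi (hγ.2.1.inter ordConnected_Ioi) hγ.isGeodesicOn hβ ⟨h0, hm1⟩ hlift
  have hoc : (dom ∪ Ioi (-1 : ℝ)).OrdConnected := by
    rw [← isPreconnected_iff_ordConnected]
    exact (isPreconnected_iff_ordConnected.2 hγ.2.1).union (0 : ℝ) h0 hm1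
      (isPreconnected_iff_ordConnected.2 ordConnected_Ioi)
  have heq : dom ∪ Ioi (-1 : ℝ) = dom :=
    hγ.2.2.2 _ _ (hγ.isOpen.union isOpen_Ioi) hoc subset_union_left hglue
      (fun t ht ↦ (hglueγ ht).symm)
  rw [← heq]
  exact subset_union_right

/-- **Every normalised future null ray of the reversed cut from the slice is future complete**: its
initial velocity has `v⁰ = -1` (normalisation `η(v, -∂ₜ) = -1`), so its affine domain contains
`(-1, ∞)`. -/
theorem not_bddAbove_of_isNormalisedNullRayFrom_reversedCut [reversedCut.metric.HasLeviCivita]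
    {p : slice} {γ : ℝ → reversedCut.carrier} {dom : Set ℝ}
    (hγ : reversedCut.metric.IsNormalisedNullRayFrom reversedCut.timeOrientation reversedCut.embed
      reversedCut.normal p γ dom) : ¬ BddAbove dom := by
  haveI : cutMetric.toPseudoRiemannianMetric.HasLeviCivita := ‹reversedCut.metric.HasLeviCivita›
  have hnorm0 := hγ.2.2.2.2.2
  set v : E4 := velocity 𝓘(ℝ, E4) γ 0 with hv_def
  have hnorm : bilin v (-(E4.basisVector 0)) = -1 := hnorm0
  have hv : v 0 = -1 := by
    rw [map_neg, bilin_symm, bilin_basisVector_zero_left] at hnorm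
    linarith
  have hsub : Ioi (-1 : ℝ) ⊆ dom :=
    Ioi_subset_dom_of_isMaximalGeodesicOn hγ.isMaximalGeodesicOn hγ.zero_mem hγ.apply_zero
      hv_def.symm hv
  exact fun hb ↦ not_bddAbove_Ioi (-1 : ℝ) (hb.mono hsub)

/-! ### The refutation -/

/-- **The orientation clause of `stub_scriTransfer` is load-bearing**: with
`PreservesTimeOrientation χ` deleted the lever is FALSE. Counter-model: `𝒟 = truncated`
(`{x⁰ < 1}`, incomplete `𝓘⁺`), `𝒮 = reversedCut` (same region, orientation `-∂ₜ`, all rays from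
the slice complete), `Φ = id`, `χ = id`, `K = K₀ = K₁ = ∅`. -/
theorem scriTransferWithoutOrientation_false : ¬ ScriTransferWithoutOrientation := by
  intro hT
  have hΦ : ContMDiff (𝓡 3) (𝓡 3) (∞ + 1) (id : slice → slice) := contMDiff_id
  have hΦ' : ∀ u, Function.Injective (mfderiv (𝓡 3) (𝓡 3) (id : slice → slice) u) := fun u ↦ by
    rw [mfderiv_id]
    exact fun _ _ h ↦ h
  -- the `Φ = id` instance of the mutated lever at the truncated development, over a general name
  -- `D'` for `id^* trivialData` (so that `reversedCut : DataEmbedding trivialData` can be fed)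
  have key : ∀ {D' : InitialDataSet (𝓡 3) slice} (_ : D' = trivialData.comap id hΦ hΦ')
      (𝒮 : DataEmbedding D') (χ : 𝒮.carrier → truncated.carrier),
      ContMDiff (𝓡 4) (𝓡 4) ∞ χ → Topology.IsOpenEmbedding χ →
      𝒮.metric.IsIsometricImmersion truncated.metric.toPseudoRiemannianMetric χ →
      χ ∘ 𝒮.embed = truncated.embed →
      (∀ [𝒮.metric.HasLeviCivita],
        ∃ K₀ : Set slice, IsCompact K₀ ∧ ∀ s : ℝ, 0 < s → ∃ K₁ : Set slice, IsCompact K₁ ∧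
          ∀ p : slice, p ∉ K₁ → ∀ (γ : ℝ → 𝒮.carrier) (dom : Set ℝ),
            𝒮.metric.IsNormalisedNullRayFrom 𝒮.timeOrientation 𝒮.embed 𝒮.normal p γ dom →
            ¬ BddAbove dom ∨ ENNReal.ofReal s ≤ sojournTime γ dom
              (𝒮.metric.causalFuture 𝒮.timeOrientation (𝒮.embed '' K₀))) →
      _root_.Summit.FinalStateConjecture.HasCompleteNullInfinity truncated.toCauchyDevelopment := by
    intro D' hD' 𝒮 χ h1 h2 h3 h4 h5
    subst hD'
    exact hT slice trivialData truncated.toCauchyDevelopment slice id hΦ hΦ' IsOpenEmbedding.id 𝒮 χ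
      h1 h2 h3 h4 ∅ isCompact_empty (by simp) h5
  refine not_hasCompleteNullInfinity_truncated (key
    (InitialDataSet.comap_eq_self_of_eq_id trivialData hΦ hΦ' rfl).symm reversedCut id contMDiff_id
    IsOpenEmbedding.id ⟨contMDiff_id, fun y ↦ congrFun (pullbackBilin_id (I := 𝓡 4) reversedCut.metric.val) y⟩
    rfl ?_)
  intro _inst
  exact ⟨∅, isCompact_empty, fun s _ ↦ ⟨∅, isCompact_empty, fun p _ γ dom hγ ↦
    Or.inl (not_bddAbove_of_isNormalisedNullRayFrom_reversedCut hγ)⟩⟩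

end Summit.FinalStateConjecture.FinalStateConjecture.Theorems.WeakCosmicCensorshipMGHD.Negative

end
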